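import Summits.QuantumFields.BalabanUV.Beta.GAN24.FibreStrip
import Summits.QuantumFields.BalabanUV.Beta.SecondOrderUnits

/-!
# `BalabanUV.Beta.GAN24.StencilSlotE3PhiLeg` — binder row G-an2-4 / (CONV-C), S-slot, road «S3-Taylor»: THE NORMALISED MULTIPLIER–MULTIPLIER
# LEG `Φ̃_N := N^{2(d+1)}·(KInv_N)_{mm}` OF THE THIRD-JET SANDWICHES IS THE K-SLOT's mm LEG — its decay from `UnitDecayK` (generic `d`), and
# UNCONDITIONALLY at `d = 3` from road P1's `FibreStrip.unitDecayK_holds` (row owner b2b-balaban-gan24-p1, gen 4)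

NOT IN PRINT; OUR PROOF ATTEMPT.  HONEST FRAMING (cell contract, verbatim): «discharging `BetaPertH` makes Bałaban's UV stability
UNCONDITIONAL — a real constructive-QFT result; it is NOT the continuum limit and NOT the Clay problem.»  HONEST DEPENDENCY (verbatim):
«continuum YM on T⁴ ⇐ BetaPertH ∧ nine spine estimates (0/9 proved); BetaPertH ⇐ (D1) ∧ (D4) ∧ CAP+tail; G-an2-4 gates asym, D1 and
NE2/3/4.»  [folklore] re-indexing of road P1's K-slot decay (`CombesThomas.UnitDecayK`, `FibreStrip.unitDecayK_holds`) BY NAME; 0 `def`,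
0 cite, 0 `Prop` mirror, 0 sorry.  This is the leg `Φ̃` of the (V-H) rows Vt∕V∕V0 and dVt∕dV of the S3 tables (`E3UnitSplit.e3VH_unit_split`'s
two-channel unit sandwich); it discharges NONE of those rows.  NOT continuum, NOT Clay.

## What is proved
* (the `mm` legs of `KInvStep Lc j = dec (Lc^j) (KInv (Lc^{j+1}))` at `Lc`-dilated points = those of `KInv (Lc^{j+1})` at its coarse points:
  an4's `SecondOrderUnits.KInvStep_mm_eq_KInv_mm`, BY NAME.)
* `phiLeg_coarse_of_unitDecayK` (generic `d`): `UnitDecayK d Lc (sfStep Lc) (smStep d Lc) C δ` ⟹ for every member `j`, with `N = Lc^{j+1}`,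
  `|N^{2(d+1)}·KInv_N (N•x′) (N•z′) (inr α) (inr β)| ≤ C·Lc^{2(d+1)}·e^{−δ·|x′ − z′|₁}` (the unit factor `Lc^{2(d+1)}` = `N^{2(d+1)} ∕ (smStep d Lc j)²`).
* `phiLeg_of_unitDecayK` — the same with a GENERAL second fine argument `w` (value `0` off the `N`-sublattice, else the bound at `quo N w`),
  and `phiLeg_left_of_unitDecayK` (general first argument): the shapes the two channels of `e3VH_unit_split` literally contain.
* `phiLeg_three` (`d = 3`, every `Lc` with `NeZero Lc`): UNCONDITIONAL, from `FibreStrip.unitDecayK_holds`.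
-/

noncomputable section

open Literature.MathematicalPhysics.QuantumFieldTheory
open Literature.MathematicalPhysics.QuantumFieldTheory.Balaban1983to89
open Literature.MathematicalPhysics.QuantumFieldTheory.Balaban1983to89.Beta
open B12Sec2to5 (l1 l1_nonneg)
open ExpKernelCalculus (MKer Decays l1_natSmul)
open Literature.Probability.LatticeModels (Torus.proj)
open LatticeForm (repZ quo)
open BlochFibreMatrix (eq_repZ_add_zsmul_quo repZ_zero)
open OneStepResolventKernel (Fib KInv proj_zsmul quo_zsmul)
open OneStepKernelFamily (KInvStep)
open Summit.QuantumFields.BalabanUV.Beta.HessKerDressedUnits (unitK unitK_apply legScale_inr)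
open Summit.QuantumFields.BalabanUV.Beta.GAN24.CombesThomas (UnitDecayK sfStep smStep)
open Summit.QuantumFields.BalabanUV.Beta.GAN24.FibreStrip (unitDecayK_holds)
open Summit.QuantumFields.BalabanUV.Beta.SecondOrderUnits (KInvStep_mm_eq_KInv_mm)

namespace Summit.QuantumFields.BalabanUV.Beta.GAN24.StencilSlotE3PhiLeg

variable {d : ℕ}

variable {Lc : ℕ} [NeZero Lc]

/-! ## §1 The normalised `mm` leg from `UnitDecayK` (the `mm` legs of `KInvStep` are an4's `SecondOrderUnits.KInvStep_mm_eq_KInv_mm`) -/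

omit [NeZero Lc] in
/-- [folklore] Unit arithmetic: `N^{2(d+1)} = Lc^{2(d+1)} · (smStep d Lc j)²`, `N = Lc^{j+1}`. -/
theorem pow_N_eq (j : ℕ) :
    (((Lc : ℝ) ^ (j + 1)) ^ (2 * (d + 1))) = (Lc : ℝ) ^ (2 * (d + 1)) * (smStep d Lc j * smStep d Lc j) := by
  simp only [smStep, ← pow_mul, ← pow_add]
  congr 1; ring

/-- **THE NORMALISED `mm` LEG AT COARSE POINTS, from `UnitDecayK`** (generic `d`): `|N^{2(d+1)}·KInv_N (N•x′) (N•z′) (inr α) (inr β)| ≤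
C·Lc^{2(d+1)}·e^{−δ|x′−z′|₁}` for every member `j` (`N = Lc^{j+1}`), with `(C, δ)` the K-slot's uniform decay data. [folklore] -/
theorem phiLeg_coarse_of_unitDecayK {C δ : ℝ} (hK : UnitDecayK d Lc (sfStep Lc) (smStep d Lc) C δ) (hδ : 0 ≤ δ) (j : ℕ)
    (x' z' : Fin (d + 1) → ℤ) (α β : Fin (d + 1)) :
    |((Lc : ℝ) ^ (j + 1)) ^ (2 * (d + 1)) *
        KInv (N := Lc ^ (j + 1)) (d := d) (((Lc ^ (j + 1) : ℕ) : ℤ) • x') (((Lc ^ (j + 1) : ℕ) : ℤ) • z') (Sum.inr α) (Sum.inr β)| ≤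
      C * (Lc : ℝ) ^ (2 * (d + 1)) * Real.exp (-δ * l1 (x' - z')) := by
  have h : |unitK (sfStep Lc j) (smStep d Lc j) (KInvStep (d := d) Lc j) ((Lc : ℤ) • x') ((Lc : ℤ) • z') (Sum.inr α) (Sum.inr β)|
      ≤ C * Real.exp (-δ * l1 ((Lc : ℤ) • x' - (Lc : ℤ) • z')) := hK j ((Lc : ℤ) • x') ((Lc : ℤ) • z') (Sum.inr α) (Sum.inr β)
  rw [unitK_apply, legScale_inr, legScale_inr, KInvStep_mm_eq_KInv_mm] at h
  have hC : 0 ≤ C := (hK 0).nonneg (Sum.inl 0)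
  have hL : (0 : ℝ) ≤ (Lc : ℝ) ^ (2 * (d + 1)) := by positivity
  -- the decay at the dilated points is at least the decay at the points
  have hexp : Real.exp (-δ * l1 ((Lc : ℤ) • x' - (Lc : ℤ) • z')) ≤ Real.exp (-δ * l1 (x' - z')) := by
    rw [Real.exp_le_exp, ← smul_sub, l1_natSmul]
    have h1 : (1 : ℝ) ≤ Lc := by exact_mod_cast Nat.one_le_iff_ne_zero.2 (NeZero.ne Lc)
    nlinarith [mul_nonneg hδ (l1_nonneg (x' - z')), h1]
  rw [pow_N_eq, show (Lc : ℝ) ^ (2 * (d + 1)) * (smStep d Lc j * smStep d Lc j) *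
      KInv (N := Lc ^ (j + 1)) (d := d) (((Lc ^ (j + 1) : ℕ) : ℤ) • x') (((Lc ^ (j + 1) : ℕ) : ℤ) • z') (Sum.inr α) (Sum.inr β) =
    (Lc : ℝ) ^ (2 * (d + 1)) * (smStep d Lc j *
      KInv (N := Lc ^ (j + 1)) (d := d) (((Lc ^ (j + 1) : ℕ) : ℤ) • x') (((Lc ^ (j + 1) : ℕ) : ℤ) • z') (Sum.inr α) (Sum.inr β) *
        smStep d Lc j) by ring, abs_mul, abs_of_nonneg hL]
  calc (Lc : ℝ) ^ (2 * (d + 1)) * _ ≤ (Lc : ℝ) ^ (2 * (d + 1)) * (C * Real.exp (-δ * l1 ((Lc : ℤ) • x' - (Lc : ℤ) • z'))) :=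
        mul_le_mul_of_nonneg_left h hL
    _ ≤ (Lc : ℝ) ^ (2 * (d + 1)) * (C * Real.exp (-δ * l1 (x' - z'))) :=
        mul_le_mul_of_nonneg_left (mul_le_mul_of_nonneg_left hexp hC) hL
    _ = C * (Lc : ℝ) ^ (2 * (d + 1)) * Real.exp (-δ * l1 (x' - z')) := by ring

/-- [folklore] A point of the `N`-sublattice is `N •` its block index. -/
theorem eq_zsmul_quo_of_proj {N : ℕ} [NeZero N] {w : Fin (d + 1) → ℤ} (hw : Torus.proj N w = 0) : w = (N : ℤ) • quo N w := by
  have h := eq_repZ_add_zsmul_quo (N := N) w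
  rw [hw, repZ_zero, zero_add] at h
  exact h

/-- **THE NORMALISED `mm` LEG, GENERAL SECOND ARGUMENT** (the literal right leg of the second channel of `e3VH_unit_split`): for every fine
`w`, `|N^{2(d+1)}·KInv_N (N•x′) w (inr α) (inr β)| ≤ C·Lc^{2(d+1)}·e^{−δ|x′ − quo N w|₁}` (the entry vanishes off the `N`-sublattice). [folklore] -/
theorem phiLeg_of_unitDecayK {C δ : ℝ} (hK : UnitDecayK d Lc (sfStep Lc) (smStep d Lc) C δ) (hδ : 0 ≤ δ) (j : ℕ)
    (x' w : Fin (d + 1) → ℤ) (α β : Fin (d + 1)) :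
    |((Lc : ℝ) ^ (j + 1)) ^ (2 * (d + 1)) *
        KInv (N := Lc ^ (j + 1)) (d := d) (((Lc ^ (j + 1) : ℕ) : ℤ) • x') w (Sum.inr α) (Sum.inr β)| ≤
      C * (Lc : ℝ) ^ (2 * (d + 1)) * Real.exp (-δ * l1 (x' - quo (Lc ^ (j + 1)) w)) := by
  by_cases hw : Torus.proj (Lc ^ (j + 1)) w = 0
  · have e := eq_zsmul_quo_of_proj (d := d) hw
    conv_lhs => rw [e]
    exact phiLeg_coarse_of_unitDecayK hK hδ j x' (quo (Lc ^ (j + 1)) w) α β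
  · have hC : 0 ≤ C := (hK 0).nonneg (Sum.inl 0)
    have h0 : KInv (N := Lc ^ (j + 1)) (d := d) (((Lc ^ (j + 1) : ℕ) : ℤ) • x') w (Sum.inr α) (Sum.inr β) = 0 := by
      simp only [KInv, hw, and_false, if_false]
    rw [h0, mul_zero, abs_zero]
    positivity

/-- **THE NORMALISED `mm` LEG, GENERAL FIRST ARGUMENT** (the literal left leg of the first channel of `e3VH_unit_split`, after the coarse
read-out of `x′`): `|N^{2(d+1)}·KInv_N y (N•z′) (inr α) (inr β)| ≤ C·Lc^{2(d+1)}·e^{−δ|quo N y − z′|₁}`. [folklore] -/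
theorem phiLeg_left_of_unitDecayK {C δ : ℝ} (hK : UnitDecayK d Lc (sfStep Lc) (smStep d Lc) C δ) (hδ : 0 ≤ δ) (j : ℕ)
    (y z' : Fin (d + 1) → ℤ) (α β : Fin (d + 1)) :
    |((Lc : ℝ) ^ (j + 1)) ^ (2 * (d + 1)) *
        KInv (N := Lc ^ (j + 1)) (d := d) y (((Lc ^ (j + 1) : ℕ) : ℤ) • z') (Sum.inr α) (Sum.inr β)| ≤
      C * (Lc : ℝ) ^ (2 * (d + 1)) * Real.exp (-δ * l1 (quo (Lc ^ (j + 1)) y - z')) := by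
  by_cases hy : Torus.proj (Lc ^ (j + 1)) y = 0
  · have e := eq_zsmul_quo_of_proj (d := d) hy
    conv_lhs => rw [e]
    exact phiLeg_coarse_of_unitDecayK hK hδ j (quo (Lc ^ (j + 1)) y) z' α β
  · have hC : 0 ≤ C := (hK 0).nonneg (Sum.inl 0)
    have h0 : KInv (N := Lc ^ (j + 1)) (d := d) y (((Lc ^ (j + 1) : ℕ) : ℤ) • z') (Sum.inr α) (Sum.inr β) = 0 := by
      simp only [KInv, hy, false_and, if_false]
    rw [h0, mul_zero, abs_zero]
    positivity

/-! ## §2 `d = 3`: unconditionally, from road P1 -/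

/-- **THE NORMALISED `mm` LEG AT `d = 3`, UNCONDITIONALLY** (every `Lc` with `NeZero Lc`; road P1's `FibreStrip.unitDecayK_holds` inside):
`∃ C δ, 0 < δ ∧ 0 ≤ C ∧` both general-argument leg bounds for every member `j`. [folklore] -/
theorem phiLeg_three : ∃ C δ : ℝ, 0 < δ ∧ 0 ≤ C ∧
    (∀ (j : ℕ) (x' w : Fin (3 + 1) → ℤ) (α β : Fin (3 + 1)),
      |((Lc : ℝ) ^ (j + 1)) ^ (2 * (3 + 1)) *
          KInv (N := Lc ^ (j + 1)) (d := 3) (((Lc ^ (j + 1) : ℕ) : ℤ) • x') w (Sum.inr α) (Sum.inr β)| ≤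
        C * Real.exp (-δ * l1 (x' - quo (Lc ^ (j + 1)) w))) ∧
    (∀ (j : ℕ) (y z' : Fin (3 + 1) → ℤ) (α β : Fin (3 + 1)),
      |((Lc : ℝ) ^ (j + 1)) ^ (2 * (3 + 1)) *
          KInv (N := Lc ^ (j + 1)) (d := 3) y (((Lc ^ (j + 1) : ℕ) : ℤ) • z') (Sum.inr α) (Sum.inr β)| ≤
        C * Real.exp (-δ * l1 (quo (Lc ^ (j + 1)) y - z'))) := by
  obtain ⟨κ, hκ, Cst, hK⟩ := unitDecayK_holds (Lc := Lc)
  have hLc : (0 : ℝ) < Lc := by exact_mod_cast Nat.pos_of_ne_zero (NeZero.ne Lc)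
  have hδpos : (0 : ℝ) < κ / ((3 + 1) * Lc) := div_pos hκ (by positivity)
  have hC : 0 ≤ Cst * Real.exp (2 * κ) := (hK 0).nonneg (Sum.inl 0)
  refine ⟨Cst * Real.exp (2 * κ) * (Lc : ℝ) ^ (2 * (3 + 1)), κ / ((3 + 1) * Lc), hδpos, mul_nonneg hC (by positivity),
    fun j x' w α β => phiLeg_of_unitDecayK hK hδpos.le j x' w α β, fun j y z' α β => phiLeg_left_of_unitDecayK hK hδpos.le j y z' α β⟩

end Summit.QuantumFields.BalabanUV.Beta.GAN24.StencilSlotE3PhiLeg
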